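/- Copyright: the b2b-balaban cell (near-miss cell 7), T⁴-continuum fan-out; row NE7b ROUND-2 swarm, seat
t4-ne7b-formalise-leaf-06 (gen 7) (road W-RP, sub-row «W-LAB», file 3: the labelled reading of a run on ITS OWN Gibbs cube
tower ⇒ W7's eleven-clause `GibbsCubeSide` BY NAME; INTENT journal l.17482).  Released under the licence of the
surrounding project. -/
import Summits.QuantumFields.BalabanUV.T4Continuum.Support.HistoryChessboardGibbsSide
import Summits.QuantumFields.BalabanUV.T4Continuum.Support.HistoryChessboardLabels
import Summits.QuantumFields.BalabanUV.T4Continuum.Support.HistoryRPTowerColumnCubes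

/-!
# Road W-RP, sub-row «W-LAB», file 3: THE LABELLED READING OF A RUN ON ITS OWN GIBBS CUBE TOWER ⇒ W7's `GibbsCubeSide`

Summits-side support leaf of the T⁴-continuum cell (rung (B)+1 on a FINITE torus only; NOT infinite volume, NOT the
mass gap, NOT the Clay statement; NOT a proof of the spine estimate NE7b).  Row NE7b, road **W-RP** (R-OWNER-23-2 ∕
R-OWNER-23-8), sub-row «W-LAB», file 3: the junction, BY NAME, of file 1 (`HistoryChessboardLabels`: the fibre lemmas
`cover_fibre`∕`fibre_subset_of_bad_lab`∕`preimage_labelSet_eq`∕`iInter_univ_labelSet` + Mathlib's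
`Set.pairwiseDisjoint_fiber`), W3n file 3 (`HistoryRPTowerColumnCubes`, leaf-07 g5: `E_meas_of_cubeColumn`,
`loc_of_cubeColumn`) and W7 file 1 (`HistoryChessboardGibbsSide`, leaf-03 g5: the eleven-clause per-cutoff event model
`GibbsCubeSide` of ONE run on ITS OWN Gibbs cube tower `gibbsTower D g₀ K`, partition function `Zrun`, source
`obsTower`).  [folklore] bookkeeping over TREE theorems; ONE hypothesis SHAPE `structure GibbsLabelSide … : Prop`
(consumed only as a binder); no definition of data, no `[cite:]` tag, no `Prop`-valued FACT minted (c1), no constant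
(c2∕c6), no exit ∕ socket ∕ `HistoryConstants` file touched (c3); nothing of W7 ∕ W3n ∕ file 1 restated.

WHAT.  `structure GibbsLabelSide D g₀ os hm₁ K P T A Bad term lab r` = W7's `GibbsCubeSide` for term events
`term ⁻¹' {τ}` and cube events `{ω | lab ω c = l}` READ OFF BY FUNCTIONS of the tower: NINE clauses — `bad_subset`,
`range`, `term_meas`, `repr` (at the fibres), the pointwise `bad_lab` and `equiv`, the σ-algebra clause `col`,
`univ_le`, `r_nonneg` — in place of W7's eleven (its five set-algebra ∕ event-geometry clauses
`ev_cover`∕`ev_disj`∕`bad_sub`∕`E_meas`∕`loc`∕`sym` become theorems); **`GibbsLabelSide.gibbsCubeSide`**; the partition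
BY NAME (`GibbsLabelSide.ev_meas ∕ ev_cover ∕ ev_disj`); `GibbsLabelSide.cutoffReading` (W4b′'s full reading,
`SU(n)`, (0.4)-averaged data) and §2 `reprA_of_labelSides` ∕ `reprB_of_labelSides` (E1∕E2 VERBATIM, W7 ∕ W-E1 BY NAME).
§1b (over W7 v1.1): `structure GibbsLabelEvents` (EIGHT clauses, no weights) ⇒ `GibbsCubeEvents` (`.gibbsCubeEvents`),
`.side os` (weights DEFINED by W7's `weight`, `repr := rfl`), `.labelSide os`, `GibbsLabelSide.events`.  Downstream (W7
file 2, leaf-03 g5): `ChessboardGibbsWitness.sideA∕B` take `GibbsCubeSide`s — a labelled run supplies them through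
`.gibbsCubeSide` ∕ `.side os`.

HONEST SCOPE (R-OWNER-23-8 wording for road W-RP).  Displayed for an instantiating seat: WHICH term label and cube
labelling of the data's Gibbs tower (that Bałaban's large-field classes per cube ARE such labels and his 𝐑-operation
terms such fibres — (EXT) proper), `repr` (the DEFINITION of the weights on road W), `bad_lab`, `col`, `equiv`,
`univ_le` ((U1)+(G2)); + NE7c ∕ NE7 ∕ rates downstream.  Nothing of H3 ∕ (B) ∕ BetaPertH discharged; 0∕9 unchanged.
NE7b NOT proved; spine 0∕9.  HONEST DEPENDENCY (cell): continuum YM on T⁴ ⇐ BetaPertH ∧ nine spine estimates (0/9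
proved); BetaPertH ⇐ (D1) ∧ (D4) ∧ CAP+tail; G-an2-4 gates asym, D1 and NE2/3/4.  This file changes none of it.
-/

open Finset MeasureTheory Literature.Barriers.CriticalPhenomena.NonGibbs Literature.Probability.LatticeModels
open Literature.MathematicalPhysics.QuantumFieldTheory.LatticeRP (IsReflectionPositiveBdd)
open Literature.MathematicalPhysics.QuantumFieldTheory.Balaban1983to89
open Literature.MathematicalPhysics.QuantumFieldTheory.Balaban1983to89.Missing
open Literature.MathematicalPhysics.QuantumFieldTheory.Balaban1983to89.T4Continuum
open Summit.QuantumFields.BalabanUV.T4Continuum HistoryChessboardEventsCutoff HistoryChessboardEventsSplit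
open HistoryChessboardEventsCubes HistoryChessboardEventsCubeSites HistoryRPTowerLaw HistoryRPTowerColumnSigma
open HistoryRPTowerColumnCubes HistoryChessboardTowerRepr HistoryChessboardGibbsSide HistoryChessboardLabels

namespace Summit.QuantumFields.BalabanUV.T4Continuum.HistoryChessboardLabelsGibbs

noncomputable section

variable {F : T4Family} {G : Type*} [GaugeGroup G] [MeasurableSpace G] [HaarData G] {ι Λ : Type*}

/-- **THE LABELLED READING OF ONE RUN ON ITS OWN GIBBS CUBE TOWER** (HYPOTHESIS SHAPE — NOTHING asserted): W7's
`GibbsCubeSide` for term events and cell events READ OFF BY FUNCTIONS of the tower — a term label `term` and a cube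
labelling `lab` —: NINE clauses, of which two pointwise (`bad_lab`, `equiv`) and one σ-algebra clause (`col`) replace
W7's five set-algebra ∕ event-geometry clauses `ev_cover`∕`ev_disj`∕`bad_sub`∕`E_meas`∕`loc`∕`sym`. [folklore] -/
structure GibbsLabelSide (D : FiniteEpsData F G) (g₀ : ℕ → ℝ) (os : List (ULoop F)) {m₁ : ℕ} (hm₁ : m₁ ≤ F.m) (K : ℕ)
    (P : Finset Λ) (T : Finset ι) (A : ℝ → ι → ℝ) (Bad : Finset ι) (term : Tower (F.P K) G K → ι)
    (lab : Tower (F.P K) G K → BlockIdx 4 (cubeCount F m₁) → Λ) (r : ℝ) : Prop where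
  /-- the bad class consists of terms -/
  bad_subset : Bad ⊆ T
  /-- every state of the tower belongs to a term of `T` -/
  range : ∀ ω, term ω ∈ T
  /-- term events are measurable -/
  term_meas : ∀ τ ∈ T, MeasurableSet (term ⁻¹' {τ})
  /-- (EXT)+(DRESS): the dressed weight of a term is `Zrun ·` the source-dressed mass of its fibre under the Gibbs tower -/
  repr : ∀ (t : ℝ), ∀ τ ∈ T,
    A t τ = Zrun D K (g₀ K) * ∫ ω in term ⁻¹' {τ}, Real.exp (t * obsTower K os ω) ∂gibbsTower D g₀ K
  /-- (EXT)∘(LOC), pointwise: a state in a bad term carries a bad label in some cube -/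
  bad_lab : ∀ ω, term ω ∈ Bad → ∃ c, lab ω c ∈ P
  /-- (LOC): the bad-label event of a cube is an event of that cube's column algebra -/
  col : ∀ l ∈ P, ∀ c : BlockIdx 4 (cubeCount F m₁),
    MeasurableSet[colAlg G K (cubeSites (K := K) (F.L ^ m₁) c)] {ω | lab ω c = l}
  /-- (R-sym), pointwise: the labelling is equivariant under the cube-boundary reflections -/
  equiv : ∀ (i : Fin 4) (k : ZMod (cubeCount F m₁)) (c : BlockIdx 4 (cubeCount F m₁)) (ω : Tower (F.P K) G K),
    lab (cubeRefl (G := G) (sitesPerDir_top_eq F hm₁ K) i k ω) c = lab ω (cellReflect i k c)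
  /-- (U1)+(G2), ratio currency: the pattern «every cube carries the bad label `l`» has probability `≤ r^(N^4)` -/
  univ_le : ∀ l ∈ P, (gibbsTower D g₀ K).real {ω | ∀ c, lab ω c = l} ≤ r ^ (cubeCount F m₁ ^ 4)
  /-- the per-cell rate is nonnegative -/
  r_nonneg : 0 ≤ r

variable {D : FiniteEpsData F G} {g₀ : ℕ → ℝ} {os : List (ULoop F)} {m₁ : ℕ} {hm₁ : m₁ ≤ F.m} {K : ℕ}
  {P : Finset Λ} {T : Finset ι} {A : ℝ → ι → ℝ} {Bad : Finset ι} {term : Tower (F.P K) G K → ι}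
  {lab : Tower (F.P K) G K → BlockIdx 4 (cubeCount F m₁) → Λ} {r : ℝ}

/-- **THE LABELLED READING IS W7's ELEVEN-CLAUSE SIDE** for the fibre events: `ev_cover`∕`ev_disj`∕`bad_sub`∕`sym` by
file 1's fibre lemmas, `E_meas`∕`loc` by W3n file 3's column producers BY NAME. [folklore] -/
theorem GibbsLabelSide.gibbsCubeSide (H : GibbsLabelSide D g₀ os hm₁ K P T A Bad term lab r) :
    GibbsCubeSide D g₀ os hm₁ K P T A Bad (fun τ => term ⁻¹' {τ}) (fun l c => {ω | lab ω c = l}) r where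
  bad_subset := H.bad_subset
  ev_meas := H.term_meas
  E_meas := E_meas_of_cubeColumn G (E := fun l c => {ω | lab ω c = l}) H.col
  repr := H.repr
  ev_cover := cover_fibre H.range
  ev_disj := Set.pairwiseDisjoint_fiber term _
  bad_sub := fibre_subset_of_bad_lab H.bad_lab
  loc := loc_of_cubeColumn G (E := fun l c => {ω | lab ω c = l}) (Nat.le_add_left K F.m) (sitesPerDir_top_eq F hm₁ K) H.col
  sym l _ i k c := preimage_labelSet_eq H.equiv l i k c
  univ_le l hl := by
    rw [iInter_univ_labelSet]
    exact H.univ_le l hl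
  r_nonneg := H.r_nonneg

/-- the term events are measurable (W-E1's `hmeas` shape). [folklore] -/
theorem GibbsLabelSide.ev_meas (H : GibbsLabelSide D g₀ os hm₁ K P T A Bad term lab r) :
    ∀ τ ∈ T, MeasurableSet (term ⁻¹' {τ}) :=
  H.term_meas

/-- the term events cover the tower (W-E1's `hcover` shape). [folklore] -/
theorem GibbsLabelSide.ev_cover (H : GibbsLabelSide D g₀ os hm₁ K P T A Bad term lab r) :
    Set.univ ⊆ ⋃ τ ∈ T, term ⁻¹' {τ} :=
  cover_fibre H.range

/-- all term events are pairwise disjoint (W-E1's `hdisj` shape; Mathlib's `Set.pairwiseDisjoint_fiber`). [folklore] -/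
theorem GibbsLabelSide.ev_disj (_H : GibbsLabelSide D g₀ os hm₁ K P T A Bad term lab r) :
    (↑T : Set ι).PairwiseDisjoint fun τ => term ⁻¹' {τ} :=
  Set.pairwiseDisjoint_fiber term _


variable {n : ℕ} [NeZero n] {Dn : FiniteEpsData F (Matrix.specialUnitaryGroup (Fin n) ℂ)}
  {ℰ : LoopAverage (Matrix.specialUnitaryGroup (Fin n) ℂ)}
  {termn : Tower (F.P K) (Matrix.specialUnitaryGroup (Fin n) ℂ) K → ι}
  {labn : Tower (F.P K) (Matrix.specialUnitaryGroup (Fin n) ℂ) K → BlockIdx 4 (cubeCount F m₁) → Λ}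

/-- **W4b′'s 21-CLAUSE READING OF A LABELLED RUN AT CUTOFF `K`** ((0.4)-block-averaged `SU(n)` data with a measurable
small-loop average): W7's `GibbsCubeSide.cutoffReading` on `.gibbsCubeSide` — `prob` and the RP five PRODUCED there.
[folklore] -/
theorem GibbsLabelSide.cutoffReading (hBA : Dn.IsBlockAveraged ℰ) (hE : ℰ.MeasurableE)
    (H : GibbsLabelSide Dn g₀ os hm₁ K P T A Bad termn labn r) :
    CutoffReading 4 (cubeCount F m₁) P T A Bad (gibbsTower Dn g₀ K) (Zrun Dn K (g₀ K)) (fun τ => termn ⁻¹' {τ})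
      (obsTower K os) 1 (fun l c => {ω | labn ω c = l}) (cubeRefl (sitesPerDir_top_eq F hm₁ K))
      (cubePos (Matrix.specialUnitaryGroup (Fin n) ℂ) (sitesPerDir_top_eq F hm₁ K)) r :=
  H.gibbsCubeSide.cutoffReading hBA hE

/-! ## §1b The labelled EVENTS reading (no weights): W7 v1.1's `GibbsCubeEvents` from eight clauses -/

/-- **THE LABELLED EVENTS READING OF ONE RUN ON ITS OWN GIBBS CUBE TOWER** (HYPOTHESIS SHAPE — NOTHING asserted): W7 v1.1's
string-independent `GibbsCubeEvents` (no weights, no `repr`, no loop string) for term events and cube events READ OFF BY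
FUNCTIONS: EIGHT clauses `bad_subset range term_meas bad_lab col equiv univ_le r_nonneg`. [folklore] -/
structure GibbsLabelEvents (D : FiniteEpsData F G) (g₀ : ℕ → ℝ) {m₁ : ℕ} (hm₁ : m₁ ≤ F.m) (K : ℕ) (P : Finset Λ)
    (T : Finset ι) (Bad : Finset ι) (term : Tower (F.P K) G K → ι)
    (lab : Tower (F.P K) G K → BlockIdx 4 (cubeCount F m₁) → Λ) (r : ℝ) : Prop where
  /-- the bad class consists of terms -/
  bad_subset : Bad ⊆ T
  /-- every state of the tower belongs to a term of `T` -/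
  range : ∀ ω, term ω ∈ T
  /-- term events are measurable -/
  term_meas : ∀ τ ∈ T, MeasurableSet (term ⁻¹' {τ})
  /-- (EXT)∘(LOC), pointwise: a state in a bad term carries a bad label in some cube -/
  bad_lab : ∀ ω, term ω ∈ Bad → ∃ c, lab ω c ∈ P
  /-- (LOC): the bad-label event of a cube is an event of that cube's column algebra -/
  col : ∀ l ∈ P, ∀ c : BlockIdx 4 (cubeCount F m₁),
    MeasurableSet[colAlg G K (cubeSites (K := K) (F.L ^ m₁) c)] {ω | lab ω c = l}
  /-- (R-sym), pointwise: the labelling is equivariant under the cube-boundary reflections -/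
  equiv : ∀ (i : Fin 4) (k : ZMod (cubeCount F m₁)) (c : BlockIdx 4 (cubeCount F m₁)) (ω : Tower (F.P K) G K),
    lab (cubeRefl (G := G) (sitesPerDir_top_eq F hm₁ K) i k ω) c = lab ω (cellReflect i k c)
  /-- (U1)+(G2), ratio currency: the pattern «every cube carries the bad label `l`» has probability `≤ r^(N^4)` -/
  univ_le : ∀ l ∈ P, (gibbsTower D g₀ K).real {ω | ∀ c, lab ω c = l} ≤ r ^ (cubeCount F m₁ ^ 4)
  /-- the per-cell rate is nonnegative -/
  r_nonneg : 0 ≤ r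

/-- **THE LABELLED EVENTS READING IS W7 v1.1's TEN-CLAUSE `GibbsCubeEvents`** for the fibre events. [folklore] -/
theorem GibbsLabelEvents.gibbsCubeEvents (H : GibbsLabelEvents D g₀ hm₁ K P T Bad term lab r) :
    GibbsCubeEvents D g₀ hm₁ K P T Bad (fun τ => term ⁻¹' {τ}) (fun l c => {ω | lab ω c = l}) r where
  bad_subset := H.bad_subset
  ev_meas := H.term_meas
  E_meas := E_meas_of_cubeColumn G (E := fun l c => {ω | lab ω c = l}) H.col
  ev_cover := cover_fibre H.range
  ev_disj := Set.pairwiseDisjoint_fiber term _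
  bad_sub := fibre_subset_of_bad_lab H.bad_lab
  loc := loc_of_cubeColumn G (E := fun l c => {ω | lab ω c = l}) (Nat.le_add_left K F.m) (sitesPerDir_top_eq F hm₁ K)
    H.col
  sym l _ i k c := preimage_labelSet_eq H.equiv l i k c
  univ_le l hl := by
    rw [iInter_univ_labelSet]
    exact H.univ_le l hl
  r_nonneg := H.r_nonneg

/-- … hence, for EVERY loop string, W7's eleven-clause side with the weights DEFINED (`weight`, `repr := rfl`).
[folklore] -/
theorem GibbsLabelEvents.side (H : GibbsLabelEvents D g₀ hm₁ K P T Bad term lab r) (os : List (ULoop F)) :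
    GibbsCubeSide D g₀ os hm₁ K P T (weight D g₀ os K fun τ => term ⁻¹' {τ}) Bad (fun τ => term ⁻¹' {τ})
      (fun l c => {ω | lab ω c = l}) r :=
  H.gibbsCubeEvents.side os

/-- … and the labelled reading with the defined weights. [folklore] -/
theorem GibbsLabelEvents.labelSide (H : GibbsLabelEvents D g₀ hm₁ K P T Bad term lab r) (os : List (ULoop F)) :
    GibbsLabelSide D g₀ os hm₁ K P T (weight D g₀ os K fun τ => term ⁻¹' {τ}) Bad term lab r where
  bad_subset := H.bad_subset
  range := H.range
  term_meas := H.term_meas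
  repr _ _ _ := rfl
  bad_lab := H.bad_lab
  col := H.col
  equiv := H.equiv
  univ_le := H.univ_le
  r_nonneg := H.r_nonneg

/-- forget the weights: a labelled reading is a labelled events reading. [folklore] -/
theorem GibbsLabelSide.events (H : GibbsLabelSide D g₀ os hm₁ K P T A Bad term lab r) :
    GibbsLabelEvents D g₀ hm₁ K P T Bad term lab r where
  bad_subset := H.bad_subset
  range := H.range
  term_meas := H.term_meas
  bad_lab := H.bad_lab
  col := H.col
  equiv := H.equiv
  univ_le := H.univ_le
  r_nonneg := H.r_nonneg

end

/-! ## §2 E1∕E2 for families of labelled readings, by name -/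

section Repr

variable {F : T4Family} {G : Type*} [GaugeGroup G] [MeasurableSpace G] [HaarData G] [RegularGaugeGroup G] {ι Λ : Type*}
  {D : FiniteEpsData F G} {g₀ : ℕ → ℝ} {os : List (ULoop F)} {m₁ : ℕ} {hm₁ : m₁ ≤ F.m} {P : Finset Λ}
  {T : ℕ → Finset ι} {Bad : ℕ → Finset ι} {K₀ : ℕ} {l₀ : ℝ}

/-- **E1 FOR RUN A FROM ITS LABELLED READINGS** (`K`-towers at `g₀ K`): W7's `reprA_of_sides` ∕ W-E1's `reprA_of_repr` —
the binder `ChessboardRoadWitness.reprA` VERBATIM; the partition comes from the term LABEL, not from a display.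
[folklore] -/
theorem reprA_of_labelSides (hM : D.AvgMeasurable) {A : ℕ → ℝ → ι → ℝ} {term : ∀ K, Tower (F.P K) G K → ι}
    {lab : ∀ K, Tower (F.P K) G K → BlockIdx 4 (cubeCount F m₁) → Λ} {r : ℕ → ℝ}
    (H : ∀ K, K₀ ≤ K → GibbsLabelSide D g₀ os hm₁ K P (T K) (A K) (Bad K) (term K) (lab K) (r K)) :
    ∀ K t, |t| ≤ l₀ → K₀ ≤ K →
      ∫ U, Real.exp (t * T4GenFunBounds.prodObs (D.scheme g₀) K os U) * D.dens K (g₀ K) 0 U ∂fieldMeasure (F.P K) 0 G =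
        ∑ τ ∈ T K, A K t τ :=
  reprA_of_sides hM fun K hK => (H K hK).gibbsCubeSide

/-- **E2 FOR RUN B FROM ITS LABELLED READINGS** (`(K+1)`-towers at `g₀ (K+1)`, terms indexed by `T K`): W7's
`reprB_of_sides` — the binder `ChessboardRoadWitness.reprB` VERBATIM. [folklore] -/
theorem reprB_of_labelSides (hM : D.AvgMeasurable) {A' : ℕ → ℝ → ι → ℝ}
    {term' : ∀ K, Tower (F.P (K + 1)) G (K + 1) → ι}
    {lab' : ∀ K, Tower (F.P (K + 1)) G (K + 1) → BlockIdx 4 (cubeCount F m₁) → Λ} {r' : ℕ → ℝ}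
    (H : ∀ K, K₀ ≤ K → GibbsLabelSide D g₀ os hm₁ (K + 1) P (T K) (A' K) (Bad K) (term' K) (lab' K) (r' K)) :
    ∀ K t, |t| ≤ l₀ → K₀ ≤ K →
      ∫ U, Real.exp (t * T4GenFunBounds.prodObs (D.scheme g₀) (K + 1) os U) * D.dens (K + 1) (g₀ (K + 1)) 0 U
          ∂fieldMeasure (F.P (K + 1)) 0 G = ∑ τ ∈ T K, A' K t τ :=
  reprB_of_sides hM fun K hK => (H K hK).gibbsCubeSide

end Repr

end Summit.QuantumFields.BalabanUV.T4Continuum.HistoryChessboardLabelsGibbs
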